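import Summits.QuantumFields.BalabanUV.Beta.GAN24.ExchangeSlotFubini
import Summits.QuantumFields.BalabanUV.Beta.GAN24.KernelLegCharges
import Summits.QuantumFields.BalabanUV.Beta.TameKernelCalculus

/-!
# `BalabanUV.Beta.GAN24.ExchangeSlotResum` — binder row G-an2-4 ∕ (CONV-C), W-slot CT-W, conservation law (C)∕(C)sym, step (L3) of this lineage's note
# `HOME/b2b-balaban-gan24-formalise-leaf-04/g65/CSYM-LEVEL0-KERNEL-BLUEPRINT.md` §6: **RESUMMING ONE SLOT OF A TWO-FACE WORD, GENERICALLY — and the ZERO of a word whose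
# resummed slot vanishes** (right slot `FF[A ∘ Q_{u′}]` and left slot `FF[Q_u ∘ B]`; generic `d`, blocking `N ≥ 1`, any bi-localised `A` ∕ `B`, any family `Q` of vertices
# bi-localised at the coarse points, bounded leg weights)

NOT IN PRINT; OUR BOOKKEEPING ([folklore] absolutely convergent lattice Fubini BY NAME over this lineage's `ExchangeSlotFubini.summable_slot_family ∕ hasSum_slot_resum` (the four-leg
majorant) and leaf-06's `KernelLegCharges.summable_exp_coarse`, an2's `ExpKernelCalculus.summable_exp_shift'`, an5's `TameKernelCalculus.trK ∕ trK_comp`; G-an2-4 formalisation swarm,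
leaf prover `b2b-balaban-gan24-formalise-leaf-04`, gen 66).  HONEST FRAMING (cell contract, verbatim): «discharging `BetaPertH` makes Bałaban's UV stability UNCONDITIONAL — a real
constructive-QFT result; it is NOT the continuum limit and NOT the Clay problem.»  HONEST DEPENDENCY (verbatim): «continuum YM on T⁴ ⇐ BetaPertH ∧ nine spine estimates (0/9 proved);
BetaPertH ⇐ (D1) ∧ (D4) ∧ CAP+tail; G-an2-4 gates asym, D1 and NE2/3/4.»

WHY (blueprint §4 (E1), §6 (L3)): the two-face words `FF[(dM_b ∘ X̃♮) ∘ dM_{b′}]` of the dressed one-step source (`DressedSourceZeroModeWords`) split, by `dM = vertexOfK S^E + vertexOfK S^VH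
+ vertexOfM M`, into sector words; `ExchangeSlotLiteral.hasSum_literal_slot` resums the lattice-summed slot of the `S^E ⊗ S^E` word only.  The present file does it for ANY
bi-localised left ∕ right factor and ANY vertex family in the resummed slot, and records the consequence used for the dead sectors: if the slot family sums to ZERO over its bond
pointwise (`HasSum (u′ ↦ Q u′ z w f g) 0` — the multiplier half-vertex `vertexOfM X̃♮_j Lc M♮` by `DressedMultiplierVertexZero.hasSum_vertexOfM_dressedStep`, the same-axis Wilson
half-vertex read at a face), the lattice-summed word VANISHES.

WHAT ([folklore]; 0 `def`, 0 cited facts, 0 `def … : Prop`, 0 sorry): §0 **`tsum_eq_tsum_of_cov`** (`Σ'_a G a c = Σ'_b G c b` for a jointly translation-covariant `G`: in the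
zero mode the lattice sum may sit on either slot), **`tsum_twoFace_shiftK`** (the two-face pair sum with `N`-periodic weights is blind to a block shift of the kernel),
**`twoFace_word_cov_of`** (a word `FF[(V_a ∘ X) ∘ W_b]` of two coarse-covariant families around a block-covariant kernel is jointly covariant), `face_weight_periodic`;
§1 (right slot) `summable_fibre_integrand`, **`tsum_word_eq_sum_fibre`** (the finite middle fibre sum moved outside the
pair `tsum`), **`hasSum_slot_word`** (`HasSum (u′ ↦ FF^{ρ₁ρ₂}_{ab}[A ∘ Q_{u′}]) (Σ_{f} Σ'_{(y,z)} ρ₁(y)·A y z a f·Σ'_{(u′,w)} ρ₂(w)·Q_{u′} z w f b)`), `summable_pair_slot`,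
**`tsum_pair_slot_eq_zero`** (`Σ'_{(u′,w)} ρ₂(w)·Q_{u′} z w f b = 0` when `Σ_{u′} Q_{u′} z w f b = 0` for every `w`), **`tsum_slot_word_eq_zero`** (`Σ'_{u′} FF[A ∘ Q_{u′}] = 0`);
§2 (left slot, by transposition `trK`) **`hasSum_slot_word_left`**, **`tsum_slot_word_left_eq_zero`** (`Σ'_u FF[Q_u ∘ B] = 0` when `Σ_u Q_u y z a f = 0`).  Asserts NO value of Bałaban's
tables; discharges NOTHING of (C)sym ∕ (Q-D) ∕ (Q-D-rate) ∕ «T2Shape» ∕ «T2Drift» ∕ (hW, hWall); NEVER «G-an2-4 closed» as (CONV-C); NOT D1, NOT `BetaPertH`, NOT continuum, NOT Clay.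
2026-08-23; no existing file touched.
-/

noncomputable section

open Finset
open scoped BigOperators
open Literature.MathematicalPhysics.QuantumFieldTheory
open Literature.MathematicalPhysics.QuantumFieldTheory.Balaban1983to89
open Literature.MathematicalPhysics.QuantumFieldTheory.Balaban1983to89.Beta
open B12Sec2to5 (l1 l1_nonneg)
open ExpKernelCalculus (Site MKer comp shiftK comp_shiftK BiLoc Zl Zl_nonneg summable_exp_shift' tsum_exp_shift')
open OneStepResolventKernel (Fib)
open Summit.QuantumFields.BalabanUV.Beta.TameKernelCalculus (trK trK_apply trK_comp biLoc_trK)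
open Summit.QuantumFields.BalabanUV.Beta.GAN24.KernelLegCharges (summable_exp_coarse)
open Summit.QuantumFields.BalabanUV.Beta.GAN24.ExchangeSlotFubini (summable_slot_family hasSum_slot_resum)

namespace Summit.QuantumFields.BalabanUV.Beta.GAN24.ExchangeSlotResum

variable {d : ℕ} {N : ℕ} [NeZero N]

/-! ## §0 Two reindexing lemmas: a jointly covariant double family; the two-face pair sum is blind to a block shift -/

/-- [folklore] **REINDEXING A JOINTLY TRANSLATION-COVARIANT DOUBLE FAMILY**: if `G (a + t) (b + t) = G a b` for all `a b t ∈ ℤ^{d+1}`, then for every `c`,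
`Σ'_a G a c = Σ'_b G c b` — both are `Σ'_v G v 0` after the translations `a = v + c`, `b = v + c` and the reflection `v ↦ −v` (`Equiv.tsum_eq`; no summability needed).
In the zero mode `Σ_{u ∈ box} Σ'_{u′}` of a jointly coarse-bond-covariant two-slot word this moves the LATTICE sum onto either slot. -/
theorem tsum_eq_tsum_of_cov {G : Site (d + 1) → Site (d + 1) → ℝ} (hG : ∀ a b t : Site (d + 1), G (a + t) (b + t) = G a b) (c : Site (d + 1)) :
    ∑' a : Site (d + 1), G a c = ∑' b : Site (d + 1), G c b := by
  have h1 : ∑' a : Site (d + 1), G a c = ∑' v : Site (d + 1), G v 0 := by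
    rw [← (Equiv.addRight c).tsum_eq (fun a : Site (d + 1) => G a c)]
    refine tsum_congr fun v => ?_
    have h := hG v 0 c
    rw [zero_add] at h
    exact h
  have h2 : ∑' b : Site (d + 1), G c b = ∑' v : Site (d + 1), G 0 v := by
    rw [← (Equiv.addRight c).tsum_eq (fun b : Site (d + 1) => G c b)]
    refine tsum_congr fun v => ?_
    have h := hG 0 v c
    rw [zero_add] at h
    exact h
  have h3 : ∑' v : Site (d + 1), G 0 v = ∑' v : Site (d + 1), G v 0 := by
    rw [← (Equiv.neg (Site (d + 1))).tsum_eq (fun v : Site (d + 1) => G v 0)]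
    refine tsum_congr fun v => ?_
    have h := hG (-v) 0 v
    rw [neg_add_cancel, zero_add] at h
    exact h
  rw [h1, h2, h3]

omit [NeZero N] in
/-- [folklore] **THE TWO-FACE PAIR `tsum` IS BLIND TO A BLOCK SHIFT OF THE KERNEL** when the leg weights are `N`-periodic:
`Σ'_{(y,w)} ρ₁(y)ρ₂(w)·(shiftK (−N•t) M) y w f g = Σ'_{(y,w)} ρ₁(y)ρ₂(w)·M y w f g` (reindexing of the pair by `(y,w) ↦ (y − N•t, w − N•t)`). -/
theorem tsum_twoFace_shiftK {ρ₁ ρ₂ : Site (d + 1) → ℝ} (hρ₁ : ∀ y s : Site (d + 1), ρ₁ (y + (N : ℤ) • s) = ρ₁ y) (hρ₂ : ∀ w s : Site (d + 1), ρ₂ (w + (N : ℤ) • s) = ρ₂ w)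
    (M : MKer (d + 1) (Fib d)) (t : Site (d + 1)) (f g : Fib d) :
    ∑' yw : Site (d + 1) × Site (d + 1), ρ₁ yw.1 * ρ₂ yw.2 * shiftK (-((N : ℤ) • t)) M yw.1 yw.2 f g =
      ∑' yw : Site (d + 1) × Site (d + 1), ρ₁ yw.1 * ρ₂ yw.2 * M yw.1 yw.2 f g := by
  have e1 : ∀ y : Site (d + 1), ρ₁ (y + -((N : ℤ) • t)) = ρ₁ y := fun y => by
    rw [show -((N : ℤ) • t) = (N : ℤ) • (-t) by rw [smul_neg], hρ₁]
  have e2 : ∀ w : Site (d + 1), ρ₂ (w + -((N : ℤ) • t)) = ρ₂ w := fun w => by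
    rw [show -((N : ℤ) • t) = (N : ℤ) • (-t) by rw [smul_neg], hρ₂]
  simp only [shiftK]
  calc ∑' yw : Site (d + 1) × Site (d + 1), ρ₁ yw.1 * ρ₂ yw.2 * M (yw.1 + -((N : ℤ) • t)) (yw.2 + -((N : ℤ) • t)) f g
      = ∑' yw : Site (d + 1) × Site (d + 1), ρ₁ (yw.1 + -((N : ℤ) • t)) * ρ₂ (yw.2 + -((N : ℤ) • t)) * M (yw.1 + -((N : ℤ) • t)) (yw.2 + -((N : ℤ) • t)) f g :=
        tsum_congr fun yw => by rw [e1, e2]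
    _ = _ := (Equiv.addRight ((-((N : ℤ) • t), -((N : ℤ) • t)) : Site (d + 1) × Site (d + 1))).tsum_eq
        (fun yw : Site (d + 1) × Site (d + 1) => ρ₁ yw.1 * ρ₂ yw.2 * M yw.1 yw.2 f g)

omit [NeZero N] in
/-- [folklore] **A TWO-FACE WORD `FF[(V_a ∘ X) ∘ W_b]` OF TWO COARSE-COVARIANT FAMILIES AROUND A BLOCK-COVARIANT KERNEL IS JOINTLY COVARIANT**:
`V (a + t) = shiftK (−N•t) (V a)`, `W (b + t) = shiftK (−N•t) (W b)`, `shiftK (−N•t) X = X`, `N`-periodic leg weights ⟹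
`FF[(V_{a+t} ∘ X) ∘ W_{b+t}] = FF[(V_a ∘ X) ∘ W_b]` (`comp_shiftK` twice, then `tsum_twoFace_shiftK`) — the hypothesis shape of `tsum_eq_tsum_of_cov`. -/
theorem twoFace_word_cov_of {V W : Site (d + 1) → MKer (d + 1) (Fib d)} {X : MKer (d + 1) (Fib d)}
    (hV : ∀ a t : Site (d + 1), V (a + t) = shiftK (-((N : ℤ) • t)) (V a)) (hW : ∀ b t : Site (d + 1), W (b + t) = shiftK (-((N : ℤ) • t)) (W b))
    (hX : ∀ t : Site (d + 1), shiftK (-((N : ℤ) • t)) X = X)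
    {ρ₁ ρ₂ : Site (d + 1) → ℝ} (hρ₁ : ∀ y s : Site (d + 1), ρ₁ (y + (N : ℤ) • s) = ρ₁ y) (hρ₂ : ∀ w s : Site (d + 1), ρ₂ (w + (N : ℤ) • s) = ρ₂ w)
    (a b t : Site (d + 1)) (f g : Fib d) :
    ∑' yw : Site (d + 1) × Site (d + 1), ρ₁ yw.1 * ρ₂ yw.2 * comp (comp (V (a + t)) X) (W (b + t)) yw.1 yw.2 f g =
      ∑' yw : Site (d + 1) × Site (d + 1), ρ₁ yw.1 * ρ₂ yw.2 * comp (comp (V a) X) (W b) yw.1 yw.2 f g := by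
  have hM : comp (comp (V (a + t)) X) (W (b + t)) = shiftK (-((N : ℤ) • t)) (comp (comp (V a) X) (W b)) := by
    rw [hV, hW, ← comp_shiftK, ← comp_shiftK, hX t]
  rw [hM]
  exact tsum_twoFace_shiftK (N := N) hρ₁ hρ₂ _ t f g

/-- [folklore] The exit-face indicator `𝟙f(n) = [n % N = N − 1]` read on a fixed coordinate is `N`-periodic on the lattice. -/
theorem face_weight_periodic (N : ℕ) (γ : Fin (d + 1)) (y s : Site (d + 1)) :
    (if (y + (N : ℤ) • s) γ % (N : ℤ) = (N : ℤ) - 1 then (1 : ℝ) else 0) = (if y γ % (N : ℤ) = (N : ℤ) - 1 then (1 : ℝ) else 0) := by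
  have e : (y + (N : ℤ) • s) γ % (N : ℤ) = y γ % (N : ℤ) := by
    simp only [Pi.add_apply, Pi.smul_apply, smul_eq_mul, Int.add_mul_emod_self_left]
  simp only [e]

/-! ## §1 The right slot -/

section Right

variable {A : MKer (d + 1) (Fib d)} {Q : Site (d + 1) → MKer (d + 1) (Fib d)} {CA CQ δ : ℝ} {p q : Site (d + 1)} {ρ₁ ρ₂ : Site (d + 1) → ℝ}

omit [NeZero N] in
/-- [folklore] The middle-leg integrand per fibre entry is summable (bi-localised left factor, bi-localised right vertex). -/
theorem summable_fibre_integrand (hδ : 0 < δ) (hA : BiLoc A p q CA δ) (hQ : ∀ u', BiLoc (Q u') ((N : ℤ) • u') ((N : ℤ) • u') CQ δ)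
    (u' y w : Site (d + 1)) (a f b : Fib d) :
    Summable fun z : Site (d + 1) => A y z a f * Q u' z w f b := by
  have hCA : 0 ≤ CA := hA.nonneg a
  have hCQ : 0 ≤ CQ := (hQ 0).nonneg a
  refine Summable.of_norm_bounded ((((summable_exp_shift' hδ q).mul_left (CA * Real.exp (-δ * l1 (y - p)))).mul_right CQ)) (fun z => ?_)
  rw [Real.norm_eq_abs, abs_mul]
  have hA' := hA y z a f
  rw [mul_add, Real.exp_add, ← mul_assoc] at hA'
  have hQ' : |Q u' z w f b| ≤ CQ :=
    (hQ u' z w f b).trans (mul_le_of_le_one_right hCQ (Real.exp_le_one_iff.2 (by nlinarith [l1_nonneg (z - (N : ℤ) • u'), l1_nonneg (w - (N : ℤ) • u')])))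
  exact mul_le_mul hA' hQ' (abs_nonneg _) (by positivity)

/-- [folklore] **THE TWO-FACE WORD WITH THE MIDDLE FIBRE SUM OUTSIDE**: for bounded leg weights,
`Σ'_{(y,w)} ρ₁(y)ρ₂(w)·(A ∘ Q_{u′}) y w a b = Σ_f Σ'_{(y,w)} ρ₁(y)ρ₂(w)·Σ'_z A y z a f·Q_{u′} z w f b` (the two interchanges are licensed by `ExchangeSlotFubini.summable_slot_family`). -/
theorem tsum_word_eq_sum_fibre (hδ : 0 < δ) (hA : BiLoc A p q CA δ) (hQ : ∀ u', BiLoc (Q u') ((N : ℤ) • u') ((N : ℤ) • u') CQ δ)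
    (h₁ : ∀ y, |ρ₁ y| ≤ 1) (h₂ : ∀ w, |ρ₂ w| ≤ 1) (u' : Site (d + 1)) (a b : Fib d) :
    ∑' yw : Site (d + 1) × Site (d + 1), ρ₁ yw.1 * ρ₂ yw.2 * comp A (Q u') yw.1 yw.2 a b =
      ∑ f : Fib d, ∑' yw : Site (d + 1) × Site (d + 1), ρ₁ yw.1 * ρ₂ yw.2 * ∑' z : Site (d + 1), A yw.1 z a f * Q u' z yw.2 f b := by
  classical
  have hCA : 0 ≤ CA := hA.nonneg a
  have hCQ : 0 ≤ CQ := (hQ 0).nonneg a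
  have hyw : ∀ f : Fib d, Summable fun yw : Site (d + 1) × Site (d + 1) => ρ₁ yw.1 * ρ₂ yw.2 * ∑' z : Site (d + 1), A yw.1 z a f * Q u' z yw.2 f b := by
    intro f
    have hΦ := summable_slot_family (N := N) (A := fun y z => A y z a f) (Q := fun u' z w => Q u' z w f b) hδ (fun y z => hA y z a f) (fun u' z w => hQ u' z w f b) hCA hCQ h₁ h₂
    refine ((hΦ.prod_factor u').prod).congr fun yw => ?_
    show ∑' z : Site (d + 1), ρ₁ yw.1 * ρ₂ yw.2 * (A yw.1 z a f * Q u' z yw.2 f b) = _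
    rw [tsum_mul_left]
  rw [← Summable.tsum_finsetSum (fun f _ => hyw f)]
  refine tsum_congr fun yw => ?_
  rw [← Finset.mul_sum]
  congr 1
  show (∑' z : Site (d + 1), ∑ f : Fib d, A yw.1 z a f * Q u' z yw.2 f b) = _
  rw [← Summable.tsum_finsetSum (fun f _ => summable_fibre_integrand (N := N) hδ hA hQ u' yw.1 yw.2 a f b)]

/-- [folklore] **RESUMMING THE RIGHT SLOT OF A TWO-FACE WORD** (bi-localised `A`, vertices `Q_{u′}` bi-localised at `N•u′`, weights bounded by `1`):
`HasSum (u′ ↦ Σ'_{(y,w)} ρ₁(y)ρ₂(w)·(A ∘ Q_{u′}) y w a b) (Σ_f Σ'_{(y,z)} ρ₁(y)·A y z a f·Σ'_{(u′,w)} ρ₂(w)·Q_{u′} z w f b)` — `ExchangeSlotFubini.hasSum_slot_resum` per fibre entry `f`. -/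
theorem hasSum_slot_word (hδ : 0 < δ) (hA : BiLoc A p q CA δ) (hQ : ∀ u', BiLoc (Q u') ((N : ℤ) • u') ((N : ℤ) • u') CQ δ)
    (h₁ : ∀ y, |ρ₁ y| ≤ 1) (h₂ : ∀ w, |ρ₂ w| ≤ 1) (a b : Fib d) :
    HasSum (fun u' : Site (d + 1) => ∑' yw : Site (d + 1) × Site (d + 1), ρ₁ yw.1 * ρ₂ yw.2 * comp A (Q u') yw.1 yw.2 a b)
      (∑ f : Fib d, ∑' yz : Site (d + 1) × Site (d + 1), ρ₁ yz.1 * A yz.1 yz.2 a f *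
        ∑' uw : Site (d + 1) × Site (d + 1), ρ₂ uw.2 * Q uw.1 yz.2 uw.2 f b) := by
  classical
  have hCA : 0 ≤ CA := hA.nonneg a
  have hCQ : 0 ≤ CQ := (hQ 0).nonneg a
  have hf : ∀ f : Fib d, HasSum (fun u' : Site (d + 1) => ∑' yw : Site (d + 1) × Site (d + 1), ρ₁ yw.1 * ρ₂ yw.2 * ∑' z : Site (d + 1), A yw.1 z a f * Q u' z yw.2 f b)
      (∑' yz : Site (d + 1) × Site (d + 1), ρ₁ yz.1 * A yz.1 yz.2 a f * ∑' uw : Site (d + 1) × Site (d + 1), ρ₂ uw.2 * Q uw.1 yz.2 uw.2 f b) :=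
    fun f => hasSum_slot_resum (N := N) (A := fun y z => A y z a f) (Q := fun u' z w => Q u' z w f b) hδ (fun y z => hA y z a f) (fun u' z w => hQ u' z w f b) hCA hCQ h₁ h₂
  have hsum := hasSum_sum (s := (Finset.univ : Finset (Fib d))) (fun f _ => hf f)
  refine hsum.congr_fun fun u' => ?_
  exact tsum_word_eq_sum_fibre (N := N) hδ hA hQ h₁ h₂ u' a b

variable (Q) in
/-- [folklore] The weighted (bond, leg) pair family of a coarse-localised vertex family is summable. -/
theorem summable_pair_slot (hδ : 0 < δ) (hQ : ∀ u', BiLoc (Q u') ((N : ℤ) • u') ((N : ℤ) • u') CQ δ) (h₂ : ∀ w, |ρ₂ w| ≤ 1) (z : Site (d + 1)) (f b : Fib d) :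
    Summable fun uw : Site (d + 1) × Site (d + 1) => ρ₂ uw.2 * Q uw.1 z uw.2 f b := by
  have hN : 1 ≤ N := Nat.one_le_iff_ne_zero.2 (NeZero.ne N)
  have hCQ : 0 ≤ CQ := (hQ 0).nonneg b
  set M : Site (d + 1) × Site (d + 1) → ℝ := fun uw => CQ * Real.exp (-δ * l1 ((N : ℤ) • uw.1 - z)) * Real.exp (-δ * l1 (uw.2 - (N : ℤ) • uw.1)) with hM
  have hM0 : 0 ≤ M := fun uw => by positivity
  have hMs : Summable M := by
    refine (summable_prod_of_nonneg hM0).2 ⟨fun u' => ?_, ?_⟩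
    · exact ((summable_exp_shift' hδ ((N : ℤ) • u')).mul_left (CQ * Real.exp (-δ * l1 ((N : ℤ) • u' - z))))
    · simp only [hM]
      simp_rw [tsum_mul_left, tsum_exp_shift']
      exact ((summable_exp_coarse hN hδ z).mul_left CQ).mul_right _
  refine Summable.of_norm_bounded hMs (fun uw => ?_)
  rw [Real.norm_eq_abs, abs_mul]
  have hq := hQ uw.1 z uw.2 f b
  rw [mul_add, Real.exp_add, ← mul_assoc, ExpKernelCalculus.l1_sub_symm z] at hq
  calc |ρ₂ uw.2| * |Q uw.1 z uw.2 f b| ≤ 1 * (CQ * Real.exp (-δ * l1 ((N : ℤ) • uw.1 - z)) * Real.exp (-δ * l1 (uw.2 - (N : ℤ) • uw.1))) :=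
        mul_le_mul (h₂ uw.2) hq (abs_nonneg _) zero_le_one
    _ = M uw := by simp only [hM, one_mul]

/-- [folklore] **A SLOT WHOSE BOND SUM VANISHES KILLS THE WEIGHTED PAIR SUM**: if `Σ_{u′} Q_{u′} z w f b = 0` for every `w`, then `Σ'_{(u′,w)} ρ₂(w)·Q_{u′} z w f b = 0`
(Fubini on the summable pair family, the `u′`-sum innermost). -/
theorem tsum_pair_slot_eq_zero (hδ : 0 < δ) (hQ : ∀ u', BiLoc (Q u') ((N : ℤ) • u') ((N : ℤ) • u') CQ δ) (h₂ : ∀ w, |ρ₂ w| ≤ 1) (z : Site (d + 1)) (f b : Fib d)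
    (h0 : ∀ w : Site (d + 1), HasSum (fun u' : Site (d + 1) => Q u' z w f b) 0) :
    ∑' uw : Site (d + 1) × Site (d + 1), ρ₂ uw.2 * Q uw.1 z uw.2 f b = 0 := by
  have hS := summable_pair_slot (N := N) Q hδ hQ h₂ z f b
  have hS' : Summable fun wu : Site (d + 1) × Site (d + 1) => ρ₂ wu.1 * Q wu.2 z wu.1 f b :=
    ((Equiv.prodComm (Site (d + 1)) (Site (d + 1))).summable_iff (f := fun uw : Site (d + 1) × Site (d + 1) => ρ₂ uw.2 * Q uw.1 z uw.2 f b)).2 hS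
  rw [← (Equiv.prodComm (Site (d + 1)) (Site (d + 1))).tsum_eq (fun uw : Site (d + 1) × Site (d + 1) => ρ₂ uw.2 * Q uw.1 z uw.2 f b)]
  show ∑' wu : Site (d + 1) × Site (d + 1), ρ₂ wu.1 * Q wu.2 z wu.1 f b = 0
  rw [hS'.tsum_prod]
  show ∑' w : Site (d + 1), ∑' u' : Site (d + 1), ρ₂ w * Q u' z w f b = 0
  simp only [tsum_mul_left, (h0 _).tsum_eq, mul_zero, tsum_zero]

/-- [folklore] **A TWO-FACE WORD WHOSE RIGHT SLOT SUMS TO ZERO OVER ITS BOND VANISHES WHEN SUMMED OVER THAT BOND**: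
`Σ'_{u′} Σ'_{(y,w)} ρ₁(y)ρ₂(w)·(A ∘ Q_{u′}) y w a b = 0` whenever `Σ_{u′} Q_{u′} z w f b = 0` for all `z w f`. -/
theorem tsum_slot_word_eq_zero (hδ : 0 < δ) (hA : BiLoc A p q CA δ) (hQ : ∀ u', BiLoc (Q u') ((N : ℤ) • u') ((N : ℤ) • u') CQ δ)
    (h₁ : ∀ y, |ρ₁ y| ≤ 1) (h₂ : ∀ w, |ρ₂ w| ≤ 1) (a b : Fib d) (h0 : ∀ (z w : Site (d + 1)) (f : Fib d), HasSum (fun u' : Site (d + 1) => Q u' z w f b) 0) :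
    ∑' u' : Site (d + 1), ∑' yw : Site (d + 1) × Site (d + 1), ρ₁ yw.1 * ρ₂ yw.2 * comp A (Q u') yw.1 yw.2 a b = 0 := by
  rw [(hasSum_slot_word (N := N) hδ hA hQ h₁ h₂ a b).tsum_eq]
  refine Finset.sum_eq_zero fun f _ => ?_
  simp only [tsum_pair_slot_eq_zero (N := N) hδ hQ h₂ _ f b (fun w => h0 _ w f), mul_zero, tsum_zero]

end Right

/-! ## §2 The left slot (by transposition) -/

section Left

variable {B : MKer (d + 1) (Fib d)} {Q : Site (d + 1) → MKer (d + 1) (Fib d)} {CB CQ δ : ℝ} {p q : Site (d + 1)} {ρ₁ ρ₂ : Site (d + 1) → ℝ}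

/-- [folklore] The two-face pair sum of `K` read at `(a, b)` with weights `(ρ₁, ρ₂)` is the two-face pair sum of `trK K` read at `(b, a)` with weights `(ρ₂, ρ₁)` (`Equiv.prodComm`). -/
theorem tsum_twoFace_eq_trK (K : MKer (d + 1) (Fib d)) (ρ₁ ρ₂ : Site (d + 1) → ℝ) (a b : Fib d) :
    ∑' yw : Site (d + 1) × Site (d + 1), ρ₁ yw.1 * ρ₂ yw.2 * K yw.1 yw.2 a b =
      ∑' wy : Site (d + 1) × Site (d + 1), ρ₂ wy.1 * ρ₁ wy.2 * trK K wy.1 wy.2 b a := by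
  rw [← (Equiv.prodComm (Site (d + 1)) (Site (d + 1))).tsum_eq (fun wy : Site (d + 1) × Site (d + 1) => ρ₂ wy.1 * ρ₁ wy.2 * trK K wy.1 wy.2 b a)]
  exact tsum_congr fun yw => by simp only [Equiv.prodComm_apply, Prod.fst_swap, Prod.snd_swap, trK_apply]; ring

/-- [folklore] **RESUMMING THE LEFT SLOT OF A TWO-FACE WORD** (vertices `Q_u` bi-localised at `N•u`, bi-localised right factor `B`, weights bounded by `1`):
`HasSum (u ↦ Σ'_{(y,w)} ρ₁(y)ρ₂(w)·(Q_u ∘ B) y w a b) (Σ_f Σ'_{(w,z)} ρ₂(w)·B z w f b·Σ'_{(u,y)} ρ₁(y)·Q_u y z a f)` — §1 on the transposed data (`trK_comp`). -/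
theorem hasSum_slot_word_left (hδ : 0 < δ) (hB : BiLoc B p q CB δ) (hQ : ∀ u, BiLoc (Q u) ((N : ℤ) • u) ((N : ℤ) • u) CQ δ)
    (h₁ : ∀ y, |ρ₁ y| ≤ 1) (h₂ : ∀ w, |ρ₂ w| ≤ 1) (a b : Fib d) :
    HasSum (fun u : Site (d + 1) => ∑' yw : Site (d + 1) × Site (d + 1), ρ₁ yw.1 * ρ₂ yw.2 * comp (Q u) B yw.1 yw.2 a b)
      (∑ f : Fib d, ∑' wz : Site (d + 1) × Site (d + 1), ρ₂ wz.1 * B wz.2 wz.1 f b *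
        ∑' uy : Site (d + 1) × Site (d + 1), ρ₁ uy.2 * Q uy.1 uy.2 wz.2 a f) := by
  have h := hasSum_slot_word (N := N) (A := trK B) (Q := fun u => trK (Q u)) (ρ₁ := ρ₂) (ρ₂ := ρ₁) hδ (biLoc_trK hB) (fun u => biLoc_trK (hQ u)) h₂ h₁ b a
  simp only [trK_apply] at h
  refine h.congr_fun fun u => ?_
  rw [tsum_twoFace_eq_trK (comp (Q u) B) ρ₁ ρ₂ a b, trK_comp]

/-- [folklore] **A TWO-FACE WORD WHOSE LEFT SLOT SUMS TO ZERO OVER ITS BOND VANISHES WHEN SUMMED OVER THAT BOND**: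
`Σ'_u Σ'_{(y,w)} ρ₁(y)ρ₂(w)·(Q_u ∘ B) y w a b = 0` whenever `Σ_u Q_u y z a f = 0` for all `y z f`. -/
theorem tsum_slot_word_left_eq_zero (hδ : 0 < δ) (hB : BiLoc B p q CB δ) (hQ : ∀ u, BiLoc (Q u) ((N : ℤ) • u) ((N : ℤ) • u) CQ δ)
    (h₁ : ∀ y, |ρ₁ y| ≤ 1) (h₂ : ∀ w, |ρ₂ w| ≤ 1) (a b : Fib d) (h0 : ∀ (y z : Site (d + 1)) (f : Fib d), HasSum (fun u : Site (d + 1) => Q u y z a f) 0) :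
    ∑' u : Site (d + 1), ∑' yw : Site (d + 1) × Site (d + 1), ρ₁ yw.1 * ρ₂ yw.2 * comp (Q u) B yw.1 yw.2 a b = 0 := by
  have e : ∀ u : Site (d + 1), (∑' yw : Site (d + 1) × Site (d + 1), ρ₁ yw.1 * ρ₂ yw.2 * comp (Q u) B yw.1 yw.2 a b) =
      ∑' wy : Site (d + 1) × Site (d + 1), ρ₂ wy.1 * ρ₁ wy.2 * comp (trK B) (trK (Q u)) wy.1 wy.2 b a := by
    intro u
    rw [tsum_twoFace_eq_trK, trK_comp]
  simp only [e]
  exact tsum_slot_word_eq_zero (N := N) (A := trK B) (Q := fun u => trK (Q u)) hδ (biLoc_trK hB) (fun u => biLoc_trK (hQ u)) h₂ h₁ b a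
    (fun z w f => by simpa only [trK_apply] using h0 w z f)

end Left

end Summit.QuantumFields.BalabanUV.Beta.GAN24.ExchangeSlotResum

end
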